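import Mathlib
import Literature.AlgebraicGeometry.Resolution.CobordantGame
import Literature.AlgebraicGeometry.Resolution.CobordantChartCoefficients
import Literature.AlgebraicGeometry.Resolution.CobordantTupleGame
import Literature.AlgebraicGeometry.Resolution.FormalCoordinateChange
import Summits.ResolutionOfSingularities.ResolutionOfSingularities.Theorems.WeightedInvariantLocalWeightedDropMonicCurveBlowup
import Summits.ResolutionOfSingularities.ResolutionOfSingularities.Theorems.WeightedInvariantLocalWeightedDropWildMonicTerminalMoves
import Summits.ResolutionOfSingularities.ResolutionOfSingularities.Theorems.WeightedInvariantLocalWeightedDropWildMonicTerminalDispatch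

/-!
# `WeightedInvariant.LocalWeightedDrop`, line `hasse-ridge-face-selection`: the CURVE STEPS of the monomial terminal class
# (scaled vertex `(a,b)/N` with `a ≥ N` or `b ≥ N`: blow up `V(x₀, y)` resp. `V(x₁, y)`)

Crux item stmt-ResolutionOfSingularities-8899 `LocalWeightedDrop` (route `ResolutionOfSingularities/WeightedInvariant`), engine of
the door `HypersurfaceCentreConstruction` stmt-ResolutionOfSingularities-19897.  [OURS · L1 W4.3, chain w43, res-type-083 (extra
seat S3ρ, CHAIN v4.3 D12): §1 (T) of `L/res-type-083/S3RHO-DESIGN.md`.  Not a statement of any manuscript.]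

`termMono_curveStep₀` / `termMono_curveStep₁`: in the monomial class with data `(N, a, b)` (see …TerminalDispatch), if `a ≥ N`
(resp. `b ≥ N`) the blow-up of the curve `V(x₀, y)` (resp. `V(x₁, y)`, brick `won_monic_of_curveBlowup`) has all its singular
successors in the class with data `(N, a - N, b)` (resp. `(N, b - N, a)`: the letters swap), of smaller `a + b` — so they are won by
the successor dispatch `won_succ_of_termMono` given the induction hypothesis below `a + b`.  The transport of (M1)–(M3) is read off
`WildMonic.coeff_curveSucc_zero/one`; the vertex test travels by `vertexTest_transport` with `τ'_j = c^{(d-j)·(a/N)} τ_j`.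
-/

set_option linter.dupNamespace false -- mandated namespace of this single-conjunct summit

namespace Summit.ResolutionOfSingularities.ResolutionOfSingularities.Theorems

open Literature.AlgebraicGeometry.Resolution
open Literature.AlgebraicGeometry.Resolution.CobordantGame

namespace WildMonic

open MvPowerSeries WildTerminal

variable {k : Type} [Field k]

/-! ### Exponent bookkeeping on `Fin 2` -/

/-- `(x e₀ + y e₁) 0 = x`. -/
theorem pair_apply_zero (x y : ℕ) : (Finsupp.single 0 x + Finsupp.single 1 y : Fin 2 →₀ ℕ) 0 = x := by simp
/-- `(x e₀ + y e₁) 1 = y`. -/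
theorem pair_apply_one (x y : ℕ) : (Finsupp.single 0 x + Finsupp.single 1 y : Fin 2 →₀ ℕ) 1 = y := by simp
/-- `(β + q e₀) 0 = β 0 + q`. -/
theorem add_single_zero_apply_zero (β : Fin 2 →₀ ℕ) (q : ℕ) : (β + Finsupp.single 0 q : Fin 2 →₀ ℕ) 0 = β 0 + q := by simp
/-- `(β + q e₀) 1 = β 1`. -/
theorem add_single_zero_apply_one (β : Fin 2 →₀ ℕ) (q : ℕ) : (β + Finsupp.single 0 q : Fin 2 →₀ ℕ) 1 = β 1 := by simp

/-- `x₀`-divisibility of every coefficient in the monomial class with `a ≥ N`. -/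
theorem exists_div₀_of_termMono {d : ℕ} (N a b : ℕ) (hN : 0 < N) (ha : N ≤ a) (A : Fin d → MvPowerSeries (Fin 2) k)
    (hM1 : ∀ (j : Fin d) (β : Fin 2 →₀ ℕ), coeff β (A j) ≠ 0 → (d - (j : ℕ)) * a ≤ N * β 0 ∧ (d - (j : ℕ)) * b ≤ N * β 1)
    (j : Fin d) : ∃ A'' : MvPowerSeries (Fin 2) k, A j = X 0 ^ (d - (j : ℕ)) * A'' :=
  exists_eq_X_pow_mul_of_coeff 0 _ (A j) fun β hβ => by
    obtain ⟨h0, -⟩ := hM1 j β hβ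
    by_contra hlt
    push Not at hlt
    have h2 : N * β 0 < N * (d - (j : ℕ)) := Nat.mul_lt_mul_of_pos_left hlt hN
    nlinarith

/-- `x₁`-divisibility of every coefficient in the monomial class with `b ≥ N`. -/
theorem exists_div₁_of_termMono {d : ℕ} (N a b : ℕ) (hN : 0 < N) (hb : N ≤ b) (A : Fin d → MvPowerSeries (Fin 2) k)
    (hM1 : ∀ (j : Fin d) (β : Fin 2 →₀ ℕ), coeff β (A j) ≠ 0 → (d - (j : ℕ)) * a ≤ N * β 0 ∧ (d - (j : ℕ)) * b ≤ N * β 1)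
    (j : Fin d) : ∃ A'' : MvPowerSeries (Fin 2) k, A j = X 1 ^ (d - (j : ℕ)) * A'' :=
  exists_eq_X_pow_mul_of_coeff 1 _ (A j) fun β hβ => by
    obtain ⟨-, h1⟩ := hM1 j β hβ
    by_contra hlt
    push Not at hlt
    have h2 : N * β 1 < N * (d - (j : ℕ)) := Nat.mul_lt_mul_of_pos_left hlt hN
    nlinarith

/-- A quotient `A_j / x_i^{d-j}` of a position coefficient has no constant term. -/
theorem constantCoeff_div_eq_zero {d : ℕ} (i : Fin 2) (A : Fin d → MvPowerSeries (Fin 2) k)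
    (hA : ∀ j : Fin d, ((d - (j : ℕ) : ℕ) : ℕ∞) < (A j).order) (j : Fin d) (A'' : MvPowerSeries (Fin 2) k)
    (h : A j = X i ^ (d - (j : ℕ)) * A'') : constantCoeff A'' = 0 := by
  have hc := coeff_add_single_X_pow_mul' i (d - (j : ℕ)) A'' 0
  rw [zero_add, ← h, coeff_zero_eq_constantCoeff] at hc
  rw [← hc]
  exact coeff_of_lt_order (by rw [Finsupp.degree_single]; exact hA j)

/-- Scaled-exponent arithmetic: `(d-j)·(N t)/N = (d-j) t`. -/
theorem scaled_div (N q t : ℕ) (hN : 0 < N) : q * (N * t) / N = q * t := by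
  rw [show q * (N * t) = N * (q * t) by ring, Nat.mul_div_cancel_left _ hN]

/-- THE CURVE STEP `V(x₀, y)` OF THE MONOMIAL CLASS (`a ≥ N`). -/
theorem termMono_curveStep₀ (p : ℕ) (hp : p.Prime) (k : Type) [Field k] [CharP k p] [IsAlgClosed k] {d : ℕ} (hd : 0 < d)
    (hord : ∀ g : MvPowerSeries (Fin 3) k, CobordantGame.IsSingular k g → g.order < d → CobordantGame.Won k 3 g)
    (haxis : ∀ g : MvPowerSeries (Fin 3) k, CobordantGame.IsSingular k g → g.order = d →
      (∃ c : Fin 3 → k, c ≠ 0 ∧ ∀ v : Fin 3 → k,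
        CobordantChart.initEval (fun _ : Fin 3 => 1) (v + c) d g = CobordantChart.initEval (fun _ : Fin 3 => 1) v d g) →
      (∀ c₁ c₂ : Fin 3 → k,
        (∀ v : Fin 3 → k, CobordantChart.initEval (fun _ : Fin 3 => 1) (v + c₁) d g =
          CobordantChart.initEval (fun _ : Fin 3 => 1) v d g) →
        (∀ v : Fin 3 → k, CobordantChart.initEval (fun _ : Fin 3 => 1) (v + c₂) d g =
          CobordantChart.initEval (fun _ : Fin 3 => 1) v d g) →
        ∃ α β : k, (α ≠ 0 ∨ β ≠ 0) ∧ α • c₁ + β • c₂ = 0) →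
      CobordantGame.Won k 3 g)
    (N : ℕ) (hN : 0 < N) (r : ℕ)
    (ih : ∀ a b : ℕ, a + b < r → ∀ A : Fin d → MvPowerSeries (Fin 2) k,
      (∀ j : Fin d, ((d - (j : ℕ) : ℕ) : ℕ∞) < (A j).order) →
      (∀ (j : Fin d) (β : Fin 2 →₀ ℕ), coeff β (A j) ≠ 0 → (d - (j : ℕ)) * a ≤ N * β 0 ∧ (d - (j : ℕ)) * b ≤ N * β 1) →
      (∃ (j₀ : Fin d) (β : Fin 2 →₀ ℕ), N * β 0 = (d - (j₀ : ℕ)) * a ∧ N * β 1 = (d - (j₀ : ℕ)) * b ∧ coeff β (A j₀) ≠ 0) →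
      (N ∣ a → N ∣ b → ∀ μ : k, ∃ j : Fin d,
        coeff (Finsupp.single 0 ((d - (j : ℕ)) * a / N) + Finsupp.single 1 ((d - (j : ℕ)) * b / N)) (A j) ≠
          (d.choose (j : ℕ) : k) * (-μ) ^ (d - (j : ℕ))) →
      CobordantGame.Won k (2 + 1) ((X (Fin.last 2) : MvPowerSeries (Fin (2 + 1)) k) ^ d +
        ∑ j : Fin d, rename (Fin.succAboveEmb (Fin.last 2)) (A j) * X (Fin.last 2) ^ (j : ℕ)))
    (a' b : ℕ) (hr : N + a' + b = r) (A : Fin d → MvPowerSeries (Fin 2) k)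
    (hA : ∀ j : Fin d, ((d - (j : ℕ) : ℕ) : ℕ∞) < (A j).order)
    (hM1 : ∀ (j : Fin d) (β : Fin 2 →₀ ℕ), coeff β (A j) ≠ 0 →
      (d - (j : ℕ)) * (N + a') ≤ N * β 0 ∧ (d - (j : ℕ)) * b ≤ N * β 1)
    (hM2 : ∃ (j₀ : Fin d) (β : Fin 2 →₀ ℕ), N * β 0 = (d - (j₀ : ℕ)) * (N + a') ∧ N * β 1 = (d - (j₀ : ℕ)) * b ∧
      coeff β (A j₀) ≠ 0)
    (hM3 : N ∣ N + a' → N ∣ b → ∀ μ : k, ∃ j : Fin d,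
      coeff (Finsupp.single 0 ((d - (j : ℕ)) * (N + a') / N) + Finsupp.single 1 ((d - (j : ℕ)) * b / N)) (A j) ≠
        (d.choose (j : ℕ) : k) * (-μ) ^ (d - (j : ℕ))) :
    CobordantGame.Won k (2 + 1) ((X (Fin.last 2) : MvPowerSeries (Fin (2 + 1)) k) ^ d +
      ∑ j : Fin d, rename (Fin.succAboveEmb (Fin.last 2)) (A j) * X (Fin.last 2) ^ (j : ℕ)) := by
  classical
  choose A'' hA'' using exists_div₀_of_termMono N (N + a') b hN (Nat.le_add_right N a') A hM1
  have hA''0 : ∀ j : Fin d, constantCoeff (A'' j) = 0 := fun j => constantCoeff_div_eq_zero 0 A hA j (A'' j) (hA'' j)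
  refine won_monic_of_curveBlowup p hp k 2 d hd 0 A A'' hA'' hA''0 fun c hc hSs => ?_
  have hcoef : ∀ (j : Fin d) (β : Fin 2 →₀ ℕ), coeff β (C (c ^ (d - (j : ℕ))) * TupleGame.slice (0 : Fin 2)
      (subst (CobordantChart.chart (fun l : Fin 2 => if l = 0 then 1 else 0) (fun l : Fin 2 => if l = 0 then c else 0)) (A'' j))) =
      c ^ (d - (j : ℕ) + β 0) * coeff (β + Finsupp.single 0 (d - (j : ℕ))) (A j) :=
    fun j β => coeff_curveSucc_zero c _ (A j) (A'' j) (hA'' j) β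
  refine won_succ_of_termMono p hp k hd hord haxis N hN r ih a' b (by omega) _ ?_ ?_ ?_ hSs
  · -- (M1)
    intro j β hβ
    rw [hcoef] at hβ
    obtain ⟨h0, h1⟩ := hM1 j _ (mul_ne_zero_iff.mp hβ).2
    rw [add_single_zero_apply_zero] at h0
    rw [add_single_zero_apply_one] at h1
    refine ⟨?_, h1⟩
    have e1 : (d - (j : ℕ)) * (N + a') = (d - (j : ℕ)) * N + (d - (j : ℕ)) * a' := Nat.mul_add _ _ _
    have e2 : N * (β 0 + (d - (j : ℕ))) = N * β 0 + N * (d - (j : ℕ)) := Nat.mul_add _ _ _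
    have e3 : (d - (j : ℕ)) * N = N * (d - (j : ℕ)) := Nat.mul_comm _ _
    omega
  · -- (M2)
    obtain ⟨j₀, β₀, h0, h1, hne⟩ := hM2
    have e1 : (d - (j₀ : ℕ)) * (N + a') = (d - (j₀ : ℕ)) * N + (d - (j₀ : ℕ)) * a' := Nat.mul_add _ _ _
    have e3 : (d - (j₀ : ℕ)) * N = N * (d - (j₀ : ℕ)) := Nat.mul_comm _ _
    have hβ₀ : d - (j₀ : ℕ) ≤ β₀ 0 := by
      have : N * (d - (j₀ : ℕ)) ≤ N * β₀ 0 := by omega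
      exact Nat.le_of_mul_le_mul_left this hN
    refine ⟨j₀, Finsupp.single 0 (β₀ 0 - (d - (j₀ : ℕ))) + Finsupp.single 1 (β₀ 1), ?_, ?_, ?_⟩
    · rw [pair_apply_zero, Nat.mul_sub, h0, e1, e3, Nat.add_sub_cancel_left]
    · rw [pair_apply_one]; exact h1
    · rw [hcoef]
      refine mul_ne_zero (pow_ne_zero _ hc) ?_
      have hβeq : Finsupp.single 0 (β₀ 0 - (d - (j₀ : ℕ))) + Finsupp.single 1 (β₀ 1) + Finsupp.single 0 (d - (j₀ : ℕ)) = β₀ := by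
        ext l; fin_cases l <;> simp; omega
      rw [hβeq]; exact hne
  · -- (M3)
    intro hNa' hNb
    have hNa : N ∣ N + a' := (Nat.dvd_add_right (dvd_refl N)).mpr hNa'
    obtain ⟨t, ht⟩ := hNa'
    refine vertexTest_transport hc (t + 1) _ _ (fun j => ?_) (hM3 hNa hNb)
    rw [hcoef]
    have he1 : (d - (j : ℕ)) * a' / N = (d - (j : ℕ)) * t := by rw [ht, scaled_div N _ t hN]
    have he2 : (d - (j : ℕ)) * (N + a') / N = (d - (j : ℕ)) * (t + 1) := by
      rw [ht, show N + N * t = N * (t + 1) by ring, scaled_div N _ (t + 1) hN]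
    have hidx : (Finsupp.single 0 ((d - (j : ℕ)) * t) + Finsupp.single 1 ((d - (j : ℕ)) * b / N) : Fin 2 →₀ ℕ) +
        Finsupp.single 0 (d - (j : ℕ)) =
        Finsupp.single 0 ((d - (j : ℕ)) * (N + a') / N) + Finsupp.single 1 ((d - (j : ℕ)) * b / N) := by
      rw [he2]; ext l; fin_cases l <;> simp; ring
    rw [pair_apply_zero, he1, hidx, show d - (j : ℕ) + (d - (j : ℕ)) * t = (d - (j : ℕ)) * (t + 1) by ring]

/-- THE CURVE STEP `V(x₁, y)` OF THE MONOMIAL CLASS (`b ≥ N`; the letters swap: new data `(N, b - N, a)`). -/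
theorem termMono_curveStep₁ (p : ℕ) (hp : p.Prime) (k : Type) [Field k] [CharP k p] [IsAlgClosed k] {d : ℕ} (hd : 0 < d)
    (hord : ∀ g : MvPowerSeries (Fin 3) k, CobordantGame.IsSingular k g → g.order < d → CobordantGame.Won k 3 g)
    (haxis : ∀ g : MvPowerSeries (Fin 3) k, CobordantGame.IsSingular k g → g.order = d →
      (∃ c : Fin 3 → k, c ≠ 0 ∧ ∀ v : Fin 3 → k,
        CobordantChart.initEval (fun _ : Fin 3 => 1) (v + c) d g = CobordantChart.initEval (fun _ : Fin 3 => 1) v d g) →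
      (∀ c₁ c₂ : Fin 3 → k,
        (∀ v : Fin 3 → k, CobordantChart.initEval (fun _ : Fin 3 => 1) (v + c₁) d g =
          CobordantChart.initEval (fun _ : Fin 3 => 1) v d g) →
        (∀ v : Fin 3 → k, CobordantChart.initEval (fun _ : Fin 3 => 1) (v + c₂) d g =
          CobordantChart.initEval (fun _ : Fin 3 => 1) v d g) →
        ∃ α β : k, (α ≠ 0 ∨ β ≠ 0) ∧ α • c₁ + β • c₂ = 0) →
      CobordantGame.Won k 3 g)
    (N : ℕ) (hN : 0 < N) (r : ℕ)
    (ih : ∀ a b : ℕ, a + b < r → ∀ A : Fin d → MvPowerSeries (Fin 2) k,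
      (∀ j : Fin d, ((d - (j : ℕ) : ℕ) : ℕ∞) < (A j).order) →
      (∀ (j : Fin d) (β : Fin 2 →₀ ℕ), coeff β (A j) ≠ 0 → (d - (j : ℕ)) * a ≤ N * β 0 ∧ (d - (j : ℕ)) * b ≤ N * β 1) →
      (∃ (j₀ : Fin d) (β : Fin 2 →₀ ℕ), N * β 0 = (d - (j₀ : ℕ)) * a ∧ N * β 1 = (d - (j₀ : ℕ)) * b ∧ coeff β (A j₀) ≠ 0) →
      (N ∣ a → N ∣ b → ∀ μ : k, ∃ j : Fin d,
        coeff (Finsupp.single 0 ((d - (j : ℕ)) * a / N) + Finsupp.single 1 ((d - (j : ℕ)) * b / N)) (A j) ≠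
          (d.choose (j : ℕ) : k) * (-μ) ^ (d - (j : ℕ))) →
      CobordantGame.Won k (2 + 1) ((X (Fin.last 2) : MvPowerSeries (Fin (2 + 1)) k) ^ d +
        ∑ j : Fin d, rename (Fin.succAboveEmb (Fin.last 2)) (A j) * X (Fin.last 2) ^ (j : ℕ)))
    (a b' : ℕ) (hr : a + (N + b') = r) (A : Fin d → MvPowerSeries (Fin 2) k)
    (hA : ∀ j : Fin d, ((d - (j : ℕ) : ℕ) : ℕ∞) < (A j).order)
    (hM1 : ∀ (j : Fin d) (β : Fin 2 →₀ ℕ), coeff β (A j) ≠ 0 →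
      (d - (j : ℕ)) * a ≤ N * β 0 ∧ (d - (j : ℕ)) * (N + b') ≤ N * β 1)
    (hM2 : ∃ (j₀ : Fin d) (β : Fin 2 →₀ ℕ), N * β 0 = (d - (j₀ : ℕ)) * a ∧ N * β 1 = (d - (j₀ : ℕ)) * (N + b') ∧
      coeff β (A j₀) ≠ 0)
    (hM3 : N ∣ a → N ∣ N + b' → ∀ μ : k, ∃ j : Fin d,
      coeff (Finsupp.single 0 ((d - (j : ℕ)) * a / N) + Finsupp.single 1 ((d - (j : ℕ)) * (N + b') / N)) (A j) ≠
        (d.choose (j : ℕ) : k) * (-μ) ^ (d - (j : ℕ))) :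
    CobordantGame.Won k (2 + 1) ((X (Fin.last 2) : MvPowerSeries (Fin (2 + 1)) k) ^ d +
      ∑ j : Fin d, rename (Fin.succAboveEmb (Fin.last 2)) (A j) * X (Fin.last 2) ^ (j : ℕ)) := by
  classical
  choose A'' hA'' using exists_div₁_of_termMono N a (N + b') hN (Nat.le_add_right N b') A hM1
  have hA''0 : ∀ j : Fin d, constantCoeff (A'' j) = 0 := fun j => constantCoeff_div_eq_zero 1 A hA j (A'' j) (hA'' j)
  refine won_monic_of_curveBlowup p hp k 2 d hd 1 A A'' hA'' hA''0 fun c hc hSs => ?_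
  have hcoef : ∀ (j : Fin d) (β : Fin 2 →₀ ℕ), coeff β (C (c ^ (d - (j : ℕ))) * TupleGame.slice (1 : Fin 2)
      (subst (CobordantChart.chart (fun l : Fin 2 => if l = 1 then 1 else 0) (fun l : Fin 2 => if l = 1 then c else 0)) (A'' j))) =
      c ^ (d - (j : ℕ) + β 0) * coeff (Finsupp.single 0 (β 1) + Finsupp.single 1 (β 0 + (d - (j : ℕ)))) (A j) :=
    fun j β => coeff_curveSucc_one c _ (A j) (A'' j) (hA'' j) β
  refine won_succ_of_termMono p hp k hd hord haxis N hN r ih b' a (by omega) _ ?_ ?_ ?_ hSs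
  · -- (M1)
    intro j β hβ
    rw [hcoef] at hβ
    obtain ⟨h0, h1⟩ := hM1 j _ (mul_ne_zero_iff.mp hβ).2
    rw [pair_apply_zero] at h0
    rw [pair_apply_one] at h1
    refine ⟨?_, h0⟩
    have e1 : (d - (j : ℕ)) * (N + b') = (d - (j : ℕ)) * N + (d - (j : ℕ)) * b' := Nat.mul_add _ _ _
    have e2 : N * (β 0 + (d - (j : ℕ))) = N * β 0 + N * (d - (j : ℕ)) := Nat.mul_add _ _ _
    have e3 : (d - (j : ℕ)) * N = N * (d - (j : ℕ)) := Nat.mul_comm _ _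
    omega
  · -- (M2)
    obtain ⟨j₀, β₀, h0, h1, hne⟩ := hM2
    have e1 : (d - (j₀ : ℕ)) * (N + b') = (d - (j₀ : ℕ)) * N + (d - (j₀ : ℕ)) * b' := Nat.mul_add _ _ _
    have e3 : (d - (j₀ : ℕ)) * N = N * (d - (j₀ : ℕ)) := Nat.mul_comm _ _
    have hβ₀ : d - (j₀ : ℕ) ≤ β₀ 1 := by
      have : N * (d - (j₀ : ℕ)) ≤ N * β₀ 1 := by omega
      exact Nat.le_of_mul_le_mul_left this hN
    refine ⟨j₀, Finsupp.single 0 (β₀ 1 - (d - (j₀ : ℕ))) + Finsupp.single 1 (β₀ 0), ?_, ?_, ?_⟩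
    · rw [pair_apply_zero, Nat.mul_sub, h1, e1, e3, Nat.add_sub_cancel_left]
    · rw [pair_apply_one]; exact h0
    · rw [hcoef, pair_apply_zero, pair_apply_one]
      refine mul_ne_zero (pow_ne_zero _ hc) ?_
      have hβeq : (Finsupp.single 0 (β₀ 0) + Finsupp.single 1 (β₀ 1 - (d - (j₀ : ℕ)) + (d - (j₀ : ℕ))) : Fin 2 →₀ ℕ) = β₀ := by
        rw [Nat.sub_add_cancel hβ₀]; exact (finsupp_two_eq β₀).symm
      rw [hβeq]; exact hne
  · -- (M3)
    intro hNb' hNa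
    have hNb : N ∣ N + b' := (Nat.dvd_add_right (dvd_refl N)).mpr hNb'
    obtain ⟨t, ht⟩ := hNb'
    refine vertexTest_transport hc (t + 1) _ _ (fun j => ?_) (hM3 hNa hNb)
    rw [hcoef, pair_apply_zero, pair_apply_one]
    have he1 : (d - (j : ℕ)) * b' / N = (d - (j : ℕ)) * t := by rw [ht, scaled_div N _ t hN]
    have he2 : (d - (j : ℕ)) * (N + b') / N = (d - (j : ℕ)) * (t + 1) := by
      rw [ht, show N + N * t = N * (t + 1) by ring, scaled_div N _ (t + 1) hN]
    rw [he1, he2, show (d - (j : ℕ)) * t + (d - (j : ℕ)) = (d - (j : ℕ)) * (t + 1) by ring,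
      show d - (j : ℕ) + (d - (j : ℕ)) * t = (d - (j : ℕ)) * (t + 1) by ring]

end WildMonic

end Summit.ResolutionOfSingularities.ResolutionOfSingularities.Theorems
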